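import Summits.BirchSwinnertonDyer.BirchSwinnertonDyer.Theses.LeadingTerm
import Summits.BirchSwinnertonDyer.BirchSwinnertonDyer.Theses.SelmerRank
import Summits.BirchSwinnertonDyer.BirchSwinnertonDyer.Theorems.LeadingTermConsistencyCells
import Summits.BirchSwinnertonDyer.BirchSwinnertonDyer.Theorems.LeadingTermConsistencyStubDeficientTwoLeMatch
import Summits.BirchSwinnertonDyer.BirchSwinnertonDyer.Theorems.LeadingTermKatoCorankBound
import HarnessLib

/-!
# BirchSwinnertonDyer / LeadingTerm — crux `Consistency` (stmt-BirchSwinnertonDyer-16217),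
# line `Sketch`, skeleton v4: modulo ITEMS the crux is its diagonal in rank `≥ 2`

The bookkeeping of skeleton v4 (`Cruxes/Consistency/Lines/Sketch.lean`, lead
`prover-line-stmt-BirchSwinnertonDyer-16217-c1-0`, 2026-08-17) with its single registered stub S2
(`stub_diagonal_two_le`, the rank-`≥ 2` `p`-adic Beilinson formula with rational constant,
Burns–Kurihara–Sano arXiv:1910.07404 Cor. 1.10 — open mathematics) spelled out as an explicit
hypothesis, so that the reduction itself is a closed theorem of the tree:

* `consistency_of_items_of_diagonalTwoLe`: S2 → `SqueezeUBR2` (crux #4) → `RankLeOne` (support,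
  stmt-16219) → `KatoCorankBound` (support, stmt-18048: Kato Thm 18.4, corank form) → route
  SelmerRank's `SelmerRankLB` (stmt-0131) → `SelmerRankSmallImage` (stmt-14418) → `Consistency`.
  Cells: `r_MW = 0` is the tree theorem `leadingTerm_consistency_of_rank_zero`; excess cells are
  empty (`SqueezeUBR2`); the diagonal is `RankLeOne` (`r = 1`) or S2 (`r ≥ 2`); EVERY deficient cell
  `1 ≤ r_MW < r_an` has `[T^{r_MW}]L_p = 0` by `deficient_coeff_eq_zero_of_items`
  (`r_MW < r_an ≤ corank_{ℤ_p} Sel_{p^∞} ≤ ord_T L_p`) and then holds with `q = 0`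
  (`consistencyAt_of_coeff_eq_zero`).
* `diagonalTwoLe_of_consistency`: conversely S2 is a literal restriction of the crux, so given the
  five items `Consistency ↔ S2` (`consistency_iff_diagonalTwoLe_of_items`).
* `consistencyOfKato_of_items_of_diagonalTwoLe`: what the route's rev-10 glue item
  `ConsistencyOfKato` (stmt-16799: `KatoDivisibility → SqueezeUBR2 → RankLeOne → Consistency`) still
  needs beyond its own hypotheses — the Selmer side (`SelmerRankLB`, `SelmerRankSmallImage`) and S2;
  Kato's divisibility (crux #5, stmt-18082) supplies `KatoCorankBound` by
  `leadingTerm_katoCorankBound_of_katoDivisibility`.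

References: Kato, Astérisque 295 (2004), Thm 18.4; Mazur–Tate–Teitelbaum, Invent. Math. 84 (1986),
§II.10; Burns–Kurihara–Sano, arXiv:1910.07404, Conj. 1.1 / Cor. 1.10.
-/

set_option linter.dupNamespace false

namespace Summit.BirchSwinnertonDyer.BirchSwinnertonDyer.Theorems

open scoped MatrixGroups ModularForm
open CongruenceSubgroup Literature.NumberTheory.EllipticCurves
  Literature.NumberTheory.EllipticCurves.ModularForms WeierstrassCurve

/-- **Modulo items, the crux `Consistency` is its diagonal in rank `≥ 2`.** Colon form. Antecedents:
(S2) the registered stub `stub_diagonal_two_le` of line `Sketch` verbatim — on the diagonal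
`r_MW = r_an ≥ 2`, one rational `q` with `L^{(r)}(E,1) = r!·q·Ω⁺_f·Reg_∞` and
`[T^r]L_p·log_p(γ)^r = q·(1-α⁻¹)²·Reg_p(D)` (rank-`≥ 2` `p`-adic Beilinson formula, open); then the
items `SqueezeUBR2` (stmt-0145), `RankLeOne` (stmt-16219), `KatoCorankBound` (stmt-18048),
`SelmerRankLB` (stmt-0131), `SelmerRankSmallImage` (stmt-14418). Consequent: the crux. Proof by
cells: `r_MW = 0` (`leadingTerm_consistency_of_rank_zero`), no excess cells (`SqueezeUBR2`),
diagonal `r = 1` (`RankLeOne`) / `r ≥ 2` (S2), deficient cells with `q = 0`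
(`deficient_coeff_eq_zero_of_items`, `consistencyAt_of_coeff_eq_zero`).
[cite: Kato2004Asterisque, Thm 18.4 (p. 281)] -/
theorem consistency_of_items_of_diagonalTwoLe :
    (∀ (W : WeierstrassCurve ℚ) [W.IsElliptic] [W.IsGloballyMinimal] (p : ℕ) [Fact p.Prime],
      5 ≤ p → Literature.NumberTheory.EllipticCurves.IsOrdinaryAt W p →
      ∀ (D : WeierstrassCurve.PAdicHeightData W p), D.IsCanonical →
      ∀ ⦃N : ℕ⦄ [NeZero N] (f : CuspForm (CongruenceSubgroup.Gamma0 N) 2),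
        Literature.NumberTheory.EllipticCurves.ModularForms.IsNewformOf W f →
        2 ≤ W.mordellWeilRank → W.analyticRank = W.mordellWeilRank →
          0 < W.regulator ∧ 0 < Literature.NumberTheory.EllipticCurves.ModularForms.plusPeriod f ∧
          ∃ q : ℚ, iteratedDeriv W.mordellWeilRank W.entireLFunction 1 =
              (((W.mordellWeilRank.factorial : ℝ) * (q : ℝ) *
                Literature.NumberTheory.EllipticCurves.ModularForms.plusPeriod f * W.regulator : ℝ) : ℂ) ∧
            PowerSeries.coeff W.mordellWeilRank
                (Literature.NumberTheory.EllipticCurves.padicLFunction f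
                  (Literature.NumberTheory.EllipticCurves.unitRoot W p : ℚ_[p])) *
                Literature.NumberTheory.EllipticCurves.padicLog p
                  (Literature.NumberTheory.EllipticCurves.cyclotomicGenerator p) ^ W.mordellWeilRank =
              (q : ℚ_[p]) * (1 - (Literature.NumberTheory.EllipticCurves.unitRoot W p : ℚ_[p])⁻¹) ^ 2 *
                WeierstrassCurve.padicRegulator D) →
    Summit.BirchSwinnertonDyer.BirchSwinnertonDyer.Theses.LeadingTerm.SqueezeUBR2 →
    Summit.BirchSwinnertonDyer.BirchSwinnertonDyer.Theses.LeadingTerm.RankLeOne →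
    Summit.BirchSwinnertonDyer.BirchSwinnertonDyer.Theses.LeadingTerm.KatoCorankBound →
    Summit.BirchSwinnertonDyer.BirchSwinnertonDyer.Theses.SelmerRank.SelmerRankLB →
    Summit.BirchSwinnertonDyer.BirchSwinnertonDyer.Theses.SelmerRank.SelmerRankSmallImage →
    Summit.BirchSwinnertonDyer.BirchSwinnertonDyer.Theses.LeadingTerm.Consistency := by
  intro hS2 hUB hR1 hKC hLB hSI W _ _ p _ h5 hord D hD N _ f hf
  rcases Nat.eq_zero_or_pos W.mordellWeilRank with h0 | hpos
  · exact leadingTerm_consistency_of_rank_zero W p hord h0 D f hf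
  have hub : W.mordellWeilRank ≤ W.analyticRank := hUB W
  rcases hub.eq_or_lt with heq | hlt
  · -- diagonal
    by_cases h1 : W.mordellWeilRank = 1
    · exact hR1 W p h5 hord h1.le heq.symm D hD f hf
    · exact hS2 W p h5 hord D hD f hf (by omega) heq.symm
  · -- deficient: one vanishing coefficient, `q = 0`
    exact consistencyAt_of_coeff_eq_zero W p D f hf hlt
      (deficient_coeff_eq_zero_of_items hLB hSI hKC W p h5 hord f hf hpos hlt)

/-- **S2 is a literal restriction of the crux**: `Consistency` implies the registered stub
`stub_diagonal_two_le` verbatim (restriction to the diagonal `r_MW = r_an ≥ 2`). [folklore] -/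
theorem diagonalTwoLe_of_consistency :
    Summit.BirchSwinnertonDyer.BirchSwinnertonDyer.Theses.LeadingTerm.Consistency →
    ∀ (W : WeierstrassCurve ℚ) [W.IsElliptic] [W.IsGloballyMinimal] (p : ℕ) [Fact p.Prime],
      5 ≤ p → Literature.NumberTheory.EllipticCurves.IsOrdinaryAt W p →
      ∀ (D : WeierstrassCurve.PAdicHeightData W p), D.IsCanonical →
      ∀ ⦃N : ℕ⦄ [NeZero N] (f : CuspForm (CongruenceSubgroup.Gamma0 N) 2),
        Literature.NumberTheory.EllipticCurves.ModularForms.IsNewformOf W f →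
        2 ≤ W.mordellWeilRank → W.analyticRank = W.mordellWeilRank →
          0 < W.regulator ∧ 0 < Literature.NumberTheory.EllipticCurves.ModularForms.plusPeriod f ∧
          ∃ q : ℚ, iteratedDeriv W.mordellWeilRank W.entireLFunction 1 =
              (((W.mordellWeilRank.factorial : ℝ) * (q : ℝ) *
                Literature.NumberTheory.EllipticCurves.ModularForms.plusPeriod f * W.regulator : ℝ) : ℂ) ∧
            PowerSeries.coeff W.mordellWeilRank
                (Literature.NumberTheory.EllipticCurves.padicLFunction f
                  (Literature.NumberTheory.EllipticCurves.unitRoot W p : ℚ_[p])) *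
                Literature.NumberTheory.EllipticCurves.padicLog p
                  (Literature.NumberTheory.EllipticCurves.cyclotomicGenerator p) ^ W.mordellWeilRank =
              (q : ℚ_[p]) * (1 - (Literature.NumberTheory.EllipticCurves.unitRoot W p : ℚ_[p])⁻¹) ^ 2 *
                WeierstrassCurve.padicRegulator D :=
  fun hC W _ _ p _ h5 hord D hD _ _ f hf _ _ => hC W p h5 hord D hD f hf

/-- **Given the five items, the crux is EQUIVALENT to S2** (`consistency_of_items_of_diagonalTwoLe`
and `diagonalTwoLe_of_consistency`). [folklore] -/
theorem consistency_iff_diagonalTwoLe_of_items :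
    Summit.BirchSwinnertonDyer.BirchSwinnertonDyer.Theses.LeadingTerm.SqueezeUBR2 →
    Summit.BirchSwinnertonDyer.BirchSwinnertonDyer.Theses.LeadingTerm.RankLeOne →
    Summit.BirchSwinnertonDyer.BirchSwinnertonDyer.Theses.LeadingTerm.KatoCorankBound →
    Summit.BirchSwinnertonDyer.BirchSwinnertonDyer.Theses.SelmerRank.SelmerRankLB →
    Summit.BirchSwinnertonDyer.BirchSwinnertonDyer.Theses.SelmerRank.SelmerRankSmallImage →
    (Summit.BirchSwinnertonDyer.BirchSwinnertonDyer.Theses.LeadingTerm.Consistency ↔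
      ∀ (W : WeierstrassCurve ℚ) [W.IsElliptic] [W.IsGloballyMinimal] (p : ℕ) [Fact p.Prime],
        5 ≤ p → Literature.NumberTheory.EllipticCurves.IsOrdinaryAt W p →
        ∀ (D : WeierstrassCurve.PAdicHeightData W p), D.IsCanonical →
        ∀ ⦃N : ℕ⦄ [NeZero N] (f : CuspForm (CongruenceSubgroup.Gamma0 N) 2),
          Literature.NumberTheory.EllipticCurves.ModularForms.IsNewformOf W f →
          2 ≤ W.mordellWeilRank → W.analyticRank = W.mordellWeilRank →
            0 < W.regulator ∧ 0 < Literature.NumberTheory.EllipticCurves.ModularForms.plusPeriod f ∧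
            ∃ q : ℚ, iteratedDeriv W.mordellWeilRank W.entireLFunction 1 =
                (((W.mordellWeilRank.factorial : ℝ) * (q : ℝ) *
                  Literature.NumberTheory.EllipticCurves.ModularForms.plusPeriod f * W.regulator : ℝ) : ℂ) ∧
              PowerSeries.coeff W.mordellWeilRank
                  (Literature.NumberTheory.EllipticCurves.padicLFunction f
                    (Literature.NumberTheory.EllipticCurves.unitRoot W p : ℚ_[p])) *
                  Literature.NumberTheory.EllipticCurves.padicLog p
                    (Literature.NumberTheory.EllipticCurves.cyclotomicGenerator p) ^ W.mordellWeilRank =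
                (q : ℚ_[p]) * (1 - (Literature.NumberTheory.EllipticCurves.unitRoot W p : ℚ_[p])⁻¹) ^ 2 *
                  WeierstrassCurve.padicRegulator D) :=
  fun hUB hR1 hKC hLB hSI =>
    ⟨fun hC => diagonalTwoLe_of_consistency hC,
      fun hS2 => consistency_of_items_of_diagonalTwoLe hS2 hUB hR1 hKC hLB hSI⟩

/-- **What the glue item `ConsistencyOfKato` (stmt-16799) needs beyond its own hypotheses**: S2 and
the Selmer side (`SelmerRankLB`, `SelmerRankSmallImage`) imply
`ConsistencyOfKato = (KatoDivisibility → SqueezeUBR2 → RankLeOne → Consistency)`, Kato's divisibility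
(crux #5, stmt-18082) giving `KatoCorankBound` (`leadingTerm_katoCorankBound_of_katoDivisibility`).
[cite: Kato2004Asterisque, Thm 17.4 (p. 273) and Thm 18.4 (p. 281)] -/
theorem consistencyOfKato_of_items_of_diagonalTwoLe :
    (∀ (W : WeierstrassCurve ℚ) [W.IsElliptic] [W.IsGloballyMinimal] (p : ℕ) [Fact p.Prime],
      5 ≤ p → Literature.NumberTheory.EllipticCurves.IsOrdinaryAt W p →
      ∀ (D : WeierstrassCurve.PAdicHeightData W p), D.IsCanonical →
      ∀ ⦃N : ℕ⦄ [NeZero N] (f : CuspForm (CongruenceSubgroup.Gamma0 N) 2),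
        Literature.NumberTheory.EllipticCurves.ModularForms.IsNewformOf W f →
        2 ≤ W.mordellWeilRank → W.analyticRank = W.mordellWeilRank →
          0 < W.regulator ∧ 0 < Literature.NumberTheory.EllipticCurves.ModularForms.plusPeriod f ∧
          ∃ q : ℚ, iteratedDeriv W.mordellWeilRank W.entireLFunction 1 =
              (((W.mordellWeilRank.factorial : ℝ) * (q : ℝ) *
                Literature.NumberTheory.EllipticCurves.ModularForms.plusPeriod f * W.regulator : ℝ) : ℂ) ∧
            PowerSeries.coeff W.mordellWeilRank
                (Literature.NumberTheory.EllipticCurves.padicLFunction f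
                  (Literature.NumberTheory.EllipticCurves.unitRoot W p : ℚ_[p])) *
                Literature.NumberTheory.EllipticCurves.padicLog p
                  (Literature.NumberTheory.EllipticCurves.cyclotomicGenerator p) ^ W.mordellWeilRank =
              (q : ℚ_[p]) * (1 - (Literature.NumberTheory.EllipticCurves.unitRoot W p : ℚ_[p])⁻¹) ^ 2 *
                WeierstrassCurve.padicRegulator D) →
    Summit.BirchSwinnertonDyer.BirchSwinnertonDyer.Theses.SelmerRank.SelmerRankLB →
    Summit.BirchSwinnertonDyer.BirchSwinnertonDyer.Theses.SelmerRank.SelmerRankSmallImage →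
    Summit.BirchSwinnertonDyer.BirchSwinnertonDyer.Theses.LeadingTerm.ConsistencyOfKato :=
  fun hS2 hLB hSI hKD hUB hR1 =>
    consistency_of_items_of_diagonalTwoLe hS2 hUB hR1
      (leadingTerm_katoCorankBound_of_katoDivisibility hKD) hLB hSI

/-! ### Promotion-ready split of S2 (two-layer plan (b) of the route docstring)

S2 is the conjunction of two INDEPENDENT conjecture-grade statements, split along the mathematics:

* (R) **BSD-rationality at the rank**, `p`-free: for `r_MW = r_an ≥ 2`,
  `L^{(r)}(E,1) ∈ ℚ · r! · Ω⁺_f · Reg_∞(E)` (Tate 1974 Conj. 4(b) / Gross, PCMS 18 (2011) Conj. 2.10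
  read modulo `ℚ^×`; open in rank `≥ 2` — there is no Gross–Zagier formula for `L''(E,1)`).
* (T) **the `p`-adic Beilinson transfer GIVEN the archimedean constant**: for `r_MW = r_an ≥ 2`,
  every good ordinary `p ≥ 5` and canonical `D`, every `q ∈ ℚ` with
  `L^{(r)}(E,1) = r!·q·Ω⁺_f·Reg_∞` also has `[T^r]L_p·log_p(γ)^r = q·(1-α⁻¹)²·Reg_p(D)`
  (Burns–Kurihara–Sano arXiv:1910.07404 Cor. 1.10 shape; Perrin-Riou 1987 is its `r = 1` case).

(R) ∧ (T) → S2 is immediate (`Reg_∞ > 0`, `Ω⁺_f > 0` are the tree theorems `regulator_pos_holds`,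
`IsNewform0.plusPeriod_pos_holds`); S2 → (R) by restriction, a good ordinary `p ≥ 5` and a canonical
`D` always existing (`exists_good_ordinary_prime_holds`, `exists_isCanonical_holds`); S2 → (T)
because the archimedean identity determines `q` (`r!·Ω⁺_f·Reg_∞ ≠ 0`). Splitting S2 by rank instead
(`r = 2` / `r ≥ 3`: `ConsistencyRankTwo → ConsistencyHigher`) is a one-line case split. -/

/-- **S2 ⟺ (R) BSD-rationality at the rank ∧ (T) the `p`-adic transfer given the constant** (see
the section docstring; left side = the registered stub `stub_diagonal_two_le` verbatim). [folklore] -/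
theorem diagonalTwoLe_iff_rationality_and_transfer :
    (∀ (W : WeierstrassCurve ℚ) [W.IsElliptic] [W.IsGloballyMinimal] (p : ℕ) [Fact p.Prime],
      5 ≤ p → Literature.NumberTheory.EllipticCurves.IsOrdinaryAt W p →
      ∀ (D : WeierstrassCurve.PAdicHeightData W p), D.IsCanonical →
      ∀ ⦃N : ℕ⦄ [NeZero N] (f : CuspForm (CongruenceSubgroup.Gamma0 N) 2),
        Literature.NumberTheory.EllipticCurves.ModularForms.IsNewformOf W f →
        2 ≤ W.mordellWeilRank → W.analyticRank = W.mordellWeilRank →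
          0 < W.regulator ∧ 0 < Literature.NumberTheory.EllipticCurves.ModularForms.plusPeriod f ∧
          ∃ q : ℚ, iteratedDeriv W.mordellWeilRank W.entireLFunction 1 =
              (((W.mordellWeilRank.factorial : ℝ) * (q : ℝ) *
                Literature.NumberTheory.EllipticCurves.ModularForms.plusPeriod f * W.regulator : ℝ) : ℂ) ∧
            PowerSeries.coeff W.mordellWeilRank
                (Literature.NumberTheory.EllipticCurves.padicLFunction f
                  (Literature.NumberTheory.EllipticCurves.unitRoot W p : ℚ_[p])) *
                Literature.NumberTheory.EllipticCurves.padicLog p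
                  (Literature.NumberTheory.EllipticCurves.cyclotomicGenerator p) ^ W.mordellWeilRank =
              (q : ℚ_[p]) * (1 - (Literature.NumberTheory.EllipticCurves.unitRoot W p : ℚ_[p])⁻¹) ^ 2 *
                WeierstrassCurve.padicRegulator D) ↔
    ((∀ (W : WeierstrassCurve ℚ) [W.IsElliptic] [W.IsGloballyMinimal]
        ⦃N : ℕ⦄ [NeZero N] (f : CuspForm (CongruenceSubgroup.Gamma0 N) 2),
        Literature.NumberTheory.EllipticCurves.ModularForms.IsNewformOf W f →
        2 ≤ W.mordellWeilRank → W.analyticRank = W.mordellWeilRank →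
          ∃ q : ℚ, iteratedDeriv W.mordellWeilRank W.entireLFunction 1 =
            (((W.mordellWeilRank.factorial : ℝ) * (q : ℝ) *
              Literature.NumberTheory.EllipticCurves.ModularForms.plusPeriod f * W.regulator : ℝ) : ℂ)) ∧
     (∀ (W : WeierstrassCurve ℚ) [W.IsElliptic] [W.IsGloballyMinimal] (p : ℕ) [Fact p.Prime],
      5 ≤ p → Literature.NumberTheory.EllipticCurves.IsOrdinaryAt W p →
      ∀ (D : WeierstrassCurve.PAdicHeightData W p), D.IsCanonical →
      ∀ ⦃N : ℕ⦄ [NeZero N] (f : CuspForm (CongruenceSubgroup.Gamma0 N) 2),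
        Literature.NumberTheory.EllipticCurves.ModularForms.IsNewformOf W f →
        2 ≤ W.mordellWeilRank → W.analyticRank = W.mordellWeilRank → ∀ q : ℚ,
          iteratedDeriv W.mordellWeilRank W.entireLFunction 1 =
              (((W.mordellWeilRank.factorial : ℝ) * (q : ℝ) *
                Literature.NumberTheory.EllipticCurves.ModularForms.plusPeriod f * W.regulator : ℝ) : ℂ) →
            PowerSeries.coeff W.mordellWeilRank
                (Literature.NumberTheory.EllipticCurves.padicLFunction f
                  (Literature.NumberTheory.EllipticCurves.unitRoot W p : ℚ_[p])) *
                Literature.NumberTheory.EllipticCurves.padicLog p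
                  (Literature.NumberTheory.EllipticCurves.cyclotomicGenerator p) ^ W.mordellWeilRank =
              (q : ℚ_[p]) * (1 - (Literature.NumberTheory.EllipticCurves.unitRoot W p : ℚ_[p])⁻¹) ^ 2 *
                WeierstrassCurve.padicRegulator D)) := by
  constructor
  · intro hS2
    refine ⟨fun W _ _ N _ f hf h2 hdiag => ?_,
      fun W _ _ p _ h5 hord D hD N _ f hf h2 hdiag q hA => ?_⟩
    · obtain ⟨p, hp, h5, hgood, hord⟩ := WeierstrassCurve.exists_good_ordinary_prime_holds W
      obtain ⟨D, hD⟩ := exists_isCanonical_holds W p h5 hgood hord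
      obtain ⟨-, -, q, hA, -⟩ := hS2 W p h5 ⟨hgood, hord⟩ D hD f hf h2 hdiag
      exact ⟨q, hA⟩
    · obtain ⟨hreg, hΩ, q', hA', hP'⟩ := hS2 W p h5 hord D hD f hf h2 hdiag
      -- the archimedean identity determines `q`
      have hqq : q = q' := by
        have hfac : (0 : ℝ) < W.mordellWeilRank.factorial := by exact_mod_cast Nat.factorial_pos _
        have h : ((W.mordellWeilRank.factorial : ℝ) * (q : ℝ) * plusPeriod f * W.regulator : ℝ) =
            ((W.mordellWeilRank.factorial : ℝ) * (q' : ℝ) * plusPeriod f * W.regulator : ℝ) := by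
          exact_mod_cast hA.symm.trans hA'
        have hne : (W.mordellWeilRank.factorial : ℝ) * plusPeriod f * W.regulator ≠ 0 :=
          mul_ne_zero (mul_ne_zero hfac.ne' hΩ.ne') hreg.ne'
        have h0 : ((q : ℝ) - q') * ((W.mordellWeilRank.factorial : ℝ) * plusPeriod f * W.regulator) =
            0 := by
          linear_combination h
        have hq : (q : ℝ) = q' := by
          have := (mul_eq_zero.mp h0).resolve_right hne
          linarith
        exact_mod_cast hq
      subst hqq
      exact hP'
  · rintro ⟨hR, hT⟩ W _ _ p _ h5 hord D hD N _ f hf h2 hdiag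
    obtain ⟨q, hA⟩ := hR W f hf h2 hdiag
    exact ⟨regulator_pos_holds W, IsNewform0.plusPeriod_pos_holds hf.1 hf.coeffField_eq_bot, q, hA,
      hT W p h5 hord D hD f hf h2 hdiag q hA⟩

end Summit.BirchSwinnertonDyer.BirchSwinnertonDyer.Theorems
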